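import Literature.NumberTheory.Sieve.PolymathLcmSumsEuler
import Mathlib.NumberTheory.LSeries.Nonvanishing
import HarnessLib

/-!
# Polymath 8b, Lemma 4.1: the Euler product of `K` against `ζ_W` ((kp-est), the simple pole, the crude bounds)

Trunk: AntSieve / parity.S13.  Part of the proof (fifth layer of the decomposition of the named fact
`Literature.NumberTheory.Sieve.frequently_nth_prime_succ_le_add_polymath`, `H₁ ≤ 246`) of the key asymptotic Lemma 4.1
of D. H. J. Polymath, *Variants of the Selberg sieve, and bounded intervals containing many primes*,
Res. Math. Sci. 1:12 (2014) = arXiv:1407.4897, p. 12 (the named fact `Literature.NumberTheory.Sieve.moebiusLcmSums_asymptotic`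
of `PolymathLcmSums.lean`).  Continuing `PolymathLcmSumsEuler.lean`, this file PROVES the comparison of
the Euler product `K = ∏_{p ∤ W} K_p` with the modified zeta function
`ζ_W(s) = ∏_{p ∤ W} (1 - p^{-s})^{-1} = ζ(s) ∏_{p ∣ W}(1 - p^{-s})` (`zetaW`, here with `N = 1`):

* (kp-est) `K_p = (1 + O_k(1/p²)) B_p` with `B_p = ∏_j (1-p^{-1-a_j})(1-p^{-1-b_j})(1-p^{-1-a_j-b_j})^{-1}`
  (`zetaFactor`), explicitly `‖K_p - B_p‖ ≤ (49k²+14k)/p²` (`(49k²+8k)/p²` for the weight `1/n`),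
  `‖B_p‖ ≥ 6^{-k}`, hence `|ε_p| ≤ C(k)/p²` with `C(k) = 6^k(49k²+14k)` for `p ≥ 7k` (`norm_localEps_le`);
* `E = ∏_{p ∤ W} (1 + ε_p)` (`epsProd`) with `‖E‖ ≤ exp(2C(k)/m)`, `‖E - 1‖ ≤ exp(2C(k)/m) - 1` when all
  primes `∤ W` are `≥ m` ("`∏_{p > w}(1 + O(1/p²)) = 1 + o(1)`");
* the Euler product of `ζ_W` (= Mathlib's `DirichletCharacter.LFunctionTrivChar W` off `s = 1`,
  `zetaW_eq_LFunctionTrivChar`) from Mathlib's Euler product of `ζ` (`tendsto_prod_inv_primesBelowNotDvd`),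
  `∏_{p<N, p∤W} B_p → Z = ∏_j ζ_W(1+a_j+b_j)/(ζ_W(1+a_j)ζ_W(1+b_j))` (`zetaLimit`, `tendsto_prod_zetaFactor`)
  and `K = E · Z` (`eulerKernel_eq_epsProd_mul_zetaLimit`);
* the crude bounds "`|ζ_W(s)|^{±1} ≤ ζ(1 + 1/log x) ≪ log x`": `∏_{p<N}(1-p^{-s})^{-1} ≤ ζ(s)` for real
  `s > 1` (`prod_primesBelow_inv_le_zetaR`, monotonicity of the partial Euler products), `‖Z‖ ≤ (ζ(1+σ)²ζ(1+2σ))^k`,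
  `‖K‖ ≤ exp(2C(k)/m)(ζ(1+σ)²ζ(1+2σ))^k` (`norm_eulerKernel_le_zeta`), and `ζ(1+σ) ≤ 2/σ` for small `σ`
  from the simple pole (`riemannZeta_residue_one`; `exists_delta_zeta_pole`, `exists_delta_zetaR_le`);
* "`∏_{p ∣ W}(1 - p^{-1-s}) = (1+o(1)) φ(W)/W`": `exists_prod_primeFactors_eq` (ratio within
  `exp(2‖s‖ω(W)) - 1` of `1` once `‖s‖ log p ≤ 1` for `p ∣ W`), with `φ(W)/W = ∏_{p∣W}(1 - 1/p)`.

## References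

* D. H. J. Polymath, *Variants of the Selberg sieve, and bounded intervals containing many primes*,
  Res. Math. Sci. 1 (2014), Art. 12; arXiv:1407.4897, proof of Lemma 4.1, p. 12, (kp-est).
  [Polymath8b2014]
-/

noncomputable section

open Filter Finset
open scoped BigOperators Topology ArithmeticFunction.Moebius

namespace Literature.NumberTheory.Sieve

namespace LcmEuler

variable {ι : Type*} [Fintype ι]

/-! ### Elementary product estimates -/

omit [Fintype ι] in
/-- `‖∏ (1 + z_j) - 1 - ∑ z_j‖ ≤ ∏ (1 + ‖z_j‖) - 1 - ∑ ‖z_j‖`. [folklore] -/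
theorem norm_prod_one_add_sub_one_sub_sum_le {κ : Type*} (s : Finset κ) (z : κ → ℂ) :
    ‖∏ j ∈ s, (1 + z j) - 1 - ∑ j ∈ s, z j‖ ≤ ∏ j ∈ s, (1 + ‖z j‖) - 1 - ∑ j ∈ s, ‖z j‖ := by
  classical
  induction s using Finset.induction_on with
  | empty => simp
  | insert a s ha ih =>
    rw [Finset.prod_insert ha, Finset.sum_insert ha, Finset.prod_insert ha, Finset.sum_insert ha]
    have e1 : (1 + z a) * ∏ j ∈ s, (1 + z j) - 1 - (z a + ∑ j ∈ s, z j) =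
        (1 + z a) * (∏ j ∈ s, (1 + z j) - 1 - ∑ j ∈ s, z j) + z a * ∑ j ∈ s, z j := by ring
    have e2 : (1 + ‖z a‖) * ∏ j ∈ s, (1 + ‖z j‖) - 1 - (‖z a‖ + ∑ j ∈ s, ‖z j‖) =
        (1 + ‖z a‖) * (∏ j ∈ s, (1 + ‖z j‖) - 1 - ∑ j ∈ s, ‖z j‖) + ‖z a‖ * ∑ j ∈ s, ‖z j‖ := by ring
    rw [e1, e2]
    refine (norm_add_le _ _).trans (add_le_add ?_ ?_)
    · rw [norm_mul]
      exact mul_le_mul ((norm_add_le _ _).trans (by rw [norm_one])) ih (norm_nonneg _)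
        (by positivity)
    · rw [norm_mul]
      exact mul_le_mul_of_nonneg_left (norm_sum_le _ _) (norm_nonneg _)

omit [Fintype ι] in
/-- `‖∏ (1 + z_j) - 1 - ∑ z_j‖ ≤ (∑ ‖z_j‖)²` when `∑ ‖z_j‖ ≤ 1`. [folklore] -/
theorem norm_prod_one_add_sub_le_sq {κ : Type*} (s : Finset κ) (z : κ → ℂ)
    (hs : ∑ j ∈ s, ‖z j‖ ≤ 1) :
    ‖∏ j ∈ s, (1 + z j) - 1 - ∑ j ∈ s, z j‖ ≤ (∑ j ∈ s, ‖z j‖) ^ 2 := by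
  refine (norm_prod_one_add_sub_one_sub_sum_le s z).trans ?_
  have h1 := Real.prod_one_add_le_exp_sum s (f := fun j => ‖z j‖) fun _ => norm_nonneg _
  have h0 : 0 ≤ ∑ j ∈ s, ‖z j‖ := Finset.sum_nonneg fun j _ => norm_nonneg _
  have h2 := Real.abs_exp_sub_one_sub_id_le (x := ∑ j ∈ s, ‖z j‖) (by rw [abs_of_nonneg h0]; exact hs)
  have h3 := (abs_le.1 h2).2
  linarith

omit [Fintype ι] in
/-- `‖∏ (1 + z_j)‖ ≤ exp(∑ ‖z_j‖)`. [folklore] -/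
theorem norm_prod_one_add_le_exp {κ : Type*} (s : Finset κ) (z : κ → ℂ) :
    ‖∏ j ∈ s, (1 + z j)‖ ≤ Real.exp (∑ j ∈ s, ‖z j‖) := by
  rw [norm_prod]
  refine le_trans ?_ (Real.prod_one_add_le_exp_sum s (f := fun j => ‖z j‖) fun _ => norm_nonneg _)
  exact Finset.prod_le_prod (fun j _ => norm_nonneg _) fun j _ => (norm_add_le _ _).trans (by simp)

/-! ### The local factors against the Euler factors of `ζ` ((kp-est)) -/

/-- `ζ`-side Euler factor
`B_p := ∏_j (1 - p^{-1-a_j})(1 - p^{-1-b_j})(1 - p^{-1-a_j-b_j})^{-1}` of (kp-est).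
[cite: Polymath8b2014, Lemma 4.1 (proof, (kp-est))] -/
def zetaFactor (a b : ι → ℂ) (q : ℕ) : ℂ :=
  ∏ j, (1 - (q : ℂ) ^ (-a j) / q) * (1 - (q : ℂ) ^ (-b j) / q) *
    (1 - (q : ℂ) ^ (-a j) * (q : ℂ) ^ (-b j) / q)⁻¹

omit [Fintype ι] in
/-- `‖p^{-a}‖ ≤ 1` for `Re a ≥ 0`, `p ≥ 1`. [folklore] -/
theorem norm_natCast_cpow_neg_le_one {q : ℕ} (hq : 0 < q) {a : ℂ} (ha : 0 ≤ a.re) :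
    ‖(q : ℂ) ^ (-a)‖ ≤ 1 := by
  rw [Complex.norm_natCast_cpow_of_pos hq, Complex.neg_re]
  exact Real.rpow_le_one_of_one_le_of_nonpos (by exact_mod_cast hq) (by linarith)

/-- **(kp-est)**: `K_p = (1 + O_k(1/p²)) B_p`, in the form `‖K_p - B_p‖ ≤ (49k² + 8k)/p²` for
`p ≥ 7k` and `‖B_p‖ ≥ 6^{-k}`, when `Re a_j, Re b_j ≥ 0`. [cite: Polymath8b2014, Lemma 4.1 (proof, (kp-est))] -/
theorem norm_localFactor_inv_sub_zetaFactor_le {a b : ι → ℂ} (hab : ∀ j, 0 ≤ (a j).re ∧ 0 ≤ (b j).re)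
    {q : ℕ} (hq : 2 ≤ q) (hqk : 7 * Fintype.card ι ≤ q) :
    ‖localFactor (fun n => (n : ℂ)⁻¹) a b q - zetaFactor a b q‖ ≤
      (49 * (Fintype.card ι : ℝ) ^ 2 + 8 * Fintype.card ι) / (q : ℝ) ^ 2 := by
  set k : ℕ := Fintype.card ι with hk
  have hq0 : (0 : ℝ) < q := by exact_mod_cast (by omega : 0 < q)
  have hq2 : (2 : ℝ) ≤ q := by exact_mod_cast hq
  have hqinv : (q : ℝ)⁻¹ ≤ 1 / 2 := by rw [inv_eq_one_div]; exact one_div_le_one_div_of_le two_pos hq2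
  have hqc : (q : ℂ) ≠ 0 := by exact_mod_cast (by omega : q ≠ 0)
  have hnq : ‖(q : ℂ)‖ = q := Complex.norm_natCast q
  -- the local quantities
  set u : ι → ℂ := fun j => (q : ℂ) ^ (-a j) / q with hu
  set v : ι → ℂ := fun j => (q : ℂ) ^ (-b j) / q with hv
  set w : ι → ℂ := fun j => (q : ℂ) ^ (-a j) * (q : ℂ) ^ (-b j) / q with hw
  have hpos : 0 < q := by omega
  have hua : ∀ j, ‖(q : ℂ) ^ (-a j)‖ ≤ 1 := fun j => norm_natCast_cpow_neg_le_one hpos (hab j).1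
  have hvb : ∀ j, ‖(q : ℂ) ^ (-b j)‖ ≤ 1 := fun j => norm_natCast_cpow_neg_le_one hpos (hab j).2
  have hun : ∀ j, ‖u j‖ ≤ (q : ℝ)⁻¹ := fun j => by
    rw [hu]; simp only; rw [norm_div, hnq, div_eq_mul_inv]
    exact mul_le_of_le_one_left (by positivity) (hua j)
  have hvn : ∀ j, ‖v j‖ ≤ (q : ℝ)⁻¹ := fun j => by
    rw [hv]; simp only; rw [norm_div, hnq, div_eq_mul_inv]
    exact mul_le_of_le_one_left (by positivity) (hvb j)
  have hwn : ∀ j, ‖w j‖ ≤ (q : ℝ)⁻¹ := fun j => by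
    rw [hw]; simp only; rw [norm_div, norm_mul, hnq, div_eq_mul_inv]
    refine mul_le_of_le_one_left (by positivity) ?_
    calc ‖(q : ℂ) ^ (-a j)‖ * ‖(q : ℂ) ^ (-b j)‖ ≤ 1 * 1 :=
        mul_le_mul (hua j) (hvb j) (norm_nonneg _) zero_le_one
      _ = 1 := one_mul 1
  -- `1 - w ≠ 0`, `‖(1 - w)⁻¹‖ ≤ 2`
  have h1w : ∀ j, (1 : ℝ) / 2 ≤ ‖1 - w j‖ := fun j => by
    have := norm_sub_norm_le (1 : ℂ) (w j)
    rw [norm_one] at this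
    linarith [hwn j]
  have h1w0 : ∀ j, (1 - w j) ≠ 0 := fun j => by
    intro h; have := h1w j; rw [h, norm_zero] at this; linarith
  -- `z_j := t_j - 1` and `d_j := w_j - u_j - v_j`
  set d : ι → ℂ := fun j => w j - u j - v j with hd
  set z : ι → ℂ := fun j => (1 - u j) * (1 - v j) * (1 - w j)⁻¹ - 1 with hz
  have hloc : localFactor (fun n => (n : ℂ)⁻¹) a b q = 1 + ∑ j, d j := by
    rw [localFactor, hd, Finset.mul_sum]
    congr 1
    refine Finset.sum_congr rfl fun j _ => ?_
    simp only [hu, hv, hw]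
    field_simp
  have hzeta : zetaFactor a b q = ∏ j, (1 + z j) := by
    rw [zetaFactor]
    refine Finset.prod_congr rfl fun j _ => ?_
    simp only [hz, hu, hv, hw]
    ring
  -- `r_j := z_j - d_j = (u v + w (w - u - v)) / (1 - w)`
  have hr : ∀ j, z j - d j = (u j * v j + w j * (w j - u j - v j)) * (1 - w j)⁻¹ := by
    intro j
    simp only [hz, hd]
    field_simp [h1w0 j]
    ring
  have hrn : ∀ j, ‖z j - d j‖ ≤ 8 / (q : ℝ) ^ 2 := by
    intro j
    rw [hr j, norm_mul, norm_inv]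
    have hA : ‖u j * v j + w j * (w j - u j - v j)‖ ≤ 4 / (q : ℝ) ^ 2 := by
      refine (norm_add_le _ _).trans ?_
      rw [norm_mul, norm_mul]
      have h3 : ‖w j - u j - v j‖ ≤ 3 * (q : ℝ)⁻¹ := by
        calc ‖w j - u j - v j‖ ≤ ‖w j‖ + ‖u j‖ + ‖v j‖ := by
              refine (norm_sub_le _ _).trans (add_le_add (norm_sub_le _ _) le_rfl)
          _ ≤ _ := by linarith [hun j, hvn j, hwn j]
      have hq2' : (q : ℝ)⁻¹ * (q : ℝ)⁻¹ = 1 / (q : ℝ) ^ 2 := by field_simp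
      calc ‖u j‖ * ‖v j‖ + ‖w j‖ * ‖w j - u j - v j‖
          ≤ (q : ℝ)⁻¹ * (q : ℝ)⁻¹ + (q : ℝ)⁻¹ * (3 * (q : ℝ)⁻¹) :=
            add_le_add (mul_le_mul (hun j) (hvn j) (norm_nonneg _) (by positivity))
              (mul_le_mul (hwn j) h3 (norm_nonneg _) (by positivity))
        _ = 4 / (q : ℝ) ^ 2 := by field_simp; ring
    have hB : ‖1 - w j‖⁻¹ ≤ 2 := by
      rw [inv_le_comm₀ (by linarith [h1w j]) two_pos]; linarith [h1w j]
    calc _ ≤ 4 / (q : ℝ) ^ 2 * 2 := mul_le_mul hA hB (by positivity) (by positivity)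
      _ = 8 / (q : ℝ) ^ 2 := by ring
  have hdn : ∀ j, ‖d j‖ ≤ 3 * (q : ℝ)⁻¹ := fun j => by
    simp only [hd]
    calc ‖w j - u j - v j‖ ≤ ‖w j‖ + ‖u j‖ + ‖v j‖ := by
          refine (norm_sub_le _ _).trans (add_le_add (norm_sub_le _ _) le_rfl)
      _ ≤ _ := by linarith [hun j, hvn j, hwn j]
  have hzn : ∀ j, ‖z j‖ ≤ 7 * (q : ℝ)⁻¹ := fun j => by
    have e : z j = d j + (z j - d j) := by ring
    rw [e]
    refine (norm_add_le _ _).trans ?_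
    have h8 : 8 / (q : ℝ) ^ 2 ≤ 4 * (q : ℝ)⁻¹ := by
      rw [div_le_iff₀ (by positivity)]
      calc (8 : ℝ) = 4 * 2 := by norm_num
        _ ≤ 4 * q := by linarith
        _ = 4 * (q : ℝ)⁻¹ * (q : ℝ) ^ 2 := by field_simp
    linarith [hdn j, hrn j]
  -- the sum of the `‖z_j‖`
  have hS : ∑ j, ‖z j‖ ≤ 7 * k * (q : ℝ)⁻¹ := by
    calc ∑ j, ‖z j‖ ≤ ∑ _j : ι, 7 * (q : ℝ)⁻¹ := Finset.sum_le_sum fun j _ => hzn j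
      _ = 7 * k * (q : ℝ)⁻¹ := by
          rw [Finset.sum_const, Finset.card_univ, nsmul_eq_mul, hk]; ring
  have hS1 : ∑ j, ‖z j‖ ≤ 1 := by
    refine hS.trans ?_
    rw [← div_eq_mul_inv, div_le_one hq0]
    exact_mod_cast hqk
  -- conclusion
  rw [hloc, hzeta]
  have e : ∏ j, (1 + z j) - (1 + ∑ j, d j) =
      (∏ j, (1 + z j) - 1 - ∑ j, z j) + ∑ j, (z j - d j) := by
    simp only [hd, Finset.sum_sub_distrib]; ring
  rw [norm_sub_rev, e]
  refine (norm_add_le _ _).trans ?_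
  have hA := norm_prod_one_add_sub_le_sq Finset.univ z hS1
  have hB : ‖∑ j, (z j - d j)‖ ≤ 8 * k / (q : ℝ) ^ 2 := by
    refine (norm_sum_le _ _).trans ?_
    calc ∑ j, ‖z j - d j‖ ≤ ∑ _j : ι, 8 / (q : ℝ) ^ 2 := Finset.sum_le_sum fun j _ => hrn j
      _ = 8 * k / (q : ℝ) ^ 2 := by
          rw [Finset.sum_const, Finset.card_univ, nsmul_eq_mul, hk]; ring
  have hA' : (∑ j, ‖z j‖) ^ 2 ≤ 49 * (k : ℝ) ^ 2 / (q : ℝ) ^ 2 := by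
    have h0 : 0 ≤ ∑ j, ‖z j‖ := Finset.sum_nonneg fun j _ => norm_nonneg _
    calc (∑ j, ‖z j‖) ^ 2 ≤ (7 * k * (q : ℝ)⁻¹) ^ 2 := pow_le_pow_left₀ h0 hS 2
      _ = 49 * (k : ℝ) ^ 2 / (q : ℝ) ^ 2 := by field_simp; ring
  calc _ ≤ 49 * (k : ℝ) ^ 2 / (q : ℝ) ^ 2 + 8 * k / (q : ℝ) ^ 2 := add_le_add (hA.trans hA') hB
    _ = _ := by ring

/-- **(kp-est)** for a general admissible weight: `‖K_p - B_p‖ ≤ (49k² + 14k)/p²` for `p ≥ 7k` ("this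
modification may be absorbed into the `1 + O(1/p²)` factor in (kp-est)").
[cite: Polymath8b2014, Lemma 4.1 (proof, (kp-est) and last paragraph)] -/
theorem norm_localFactor_sub_zetaFactor_le {w : ℕ → ℂ} (hw : IsLcmWeight w) {a b : ι → ℂ}
    (hab : ∀ j, 0 ≤ (a j).re ∧ 0 ≤ (b j).re) {q : ℕ} (hqp : q.Prime) (hqk : 7 * Fintype.card ι ≤ q) :
    ‖localFactor w a b q - zetaFactor a b q‖ ≤
      (49 * (Fintype.card ι : ℝ) ^ 2 + 14 * Fintype.card ι) / (q : ℝ) ^ 2 := by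
  have hq := hqp.two_le
  have hpos : 0 < q := by omega
  have h1 := norm_localFactor_inv_sub_zetaFactor_le hab hq hqk
  have hS : ‖∑ j, ((q : ℂ) ^ (-a j) * (q : ℂ) ^ (-b j) - (q : ℂ) ^ (-a j) - (q : ℂ) ^ (-b j))‖ ≤
      3 * Fintype.card ι := by
    refine (norm_sum_le _ _).trans ?_
    have hle : ∀ j ∈ Finset.univ, ‖(q : ℂ) ^ (-a j) * (q : ℂ) ^ (-b j) - (q : ℂ) ^ (-a j) - (q : ℂ) ^ (-b j)‖ ≤ 3 := by
      intro j _
      have hua := norm_natCast_cpow_neg_le_one hpos (hab j).1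
      have hvb := norm_natCast_cpow_neg_le_one hpos (hab j).2
      calc _ ≤ ‖(q : ℂ) ^ (-a j) * (q : ℂ) ^ (-b j)‖ + ‖(q : ℂ) ^ (-a j)‖ + ‖(q : ℂ) ^ (-b j)‖ := by
            refine (norm_sub_le _ _).trans (add_le_add (norm_sub_le _ _) le_rfl)
        _ ≤ 1 * 1 + 1 + 1 := by
            rw [norm_mul]
            exact add_le_add (add_le_add (mul_le_mul hua hvb (norm_nonneg _) zero_le_one) hua) hvb
        _ = 3 := by norm_num
    calc _ ≤ ∑ _j : ι, (3 : ℝ) := Finset.sum_le_sum hle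
      _ = 3 * Fintype.card ι := by rw [Finset.sum_const, Finset.card_univ, nsmul_eq_mul]; ring
  have hdiff : ‖localFactor w a b q - localFactor (fun n => (n : ℂ)⁻¹) a b q‖ ≤
      6 * Fintype.card ι / (q : ℝ) ^ 2 := by
    have e : localFactor w a b q - localFactor (fun n => (n : ℂ)⁻¹) a b q =
        (w q - (q : ℂ)⁻¹) * ∑ j, ((q : ℂ) ^ (-a j) * (q : ℂ) ^ (-b j) - (q : ℂ) ^ (-a j) - (q : ℂ) ^ (-b j)) := by
      simp only [localFactor]; ring
    rw [e, norm_mul]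
    calc _ ≤ 2 / (q : ℝ) ^ 2 * (3 * Fintype.card ι) :=
          mul_le_mul (hw.sub_le q hqp) hS (norm_nonneg _) (by positivity)
      _ = _ := by ring
  have e2 : localFactor w a b q - zetaFactor a b q =
      (localFactor w a b q - localFactor (fun n => (n : ℂ)⁻¹) a b q) +
        (localFactor (fun n => (n : ℂ)⁻¹) a b q - zetaFactor a b q) := by ring
  rw [e2]
  refine (norm_add_le _ _).trans ?_
  calc _ ≤ 6 * Fintype.card ι / (q : ℝ) ^ 2 + (49 * (Fintype.card ι : ℝ) ^ 2 + 8 * Fintype.card ι) / (q : ℝ) ^ 2 :=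
        add_le_add hdiff h1
    _ = _ := by ring

/-- `‖B_p‖ ≥ 6^{-k}` (each factor has `|1 - u| ≥ 1/2`, `|1 - v| ≥ 1/2`, `|1/(1-w)| ≥ 2/3`). [folklore] -/
theorem norm_zetaFactor_ge {a b : ι → ℂ} (hab : ∀ j, 0 ≤ (a j).re ∧ 0 ≤ (b j).re)
    {q : ℕ} (hq : 2 ≤ q) :
    (1 / 6 : ℝ) ^ Fintype.card ι ≤ ‖zetaFactor a b q‖ := by
  have hpos : 0 < q := by omega
  have hq2 : (2 : ℝ) ≤ q := by exact_mod_cast hq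
  have hnq : ‖(q : ℂ)‖ = q := Complex.norm_natCast q
  have hinv : (q : ℝ)⁻¹ ≤ 1 / 2 := by rw [inv_eq_one_div]; exact one_div_le_one_div_of_le two_pos hq2
  rw [zetaFactor, norm_prod, ← Finset.card_univ, ← Finset.prod_const]
  refine Finset.prod_le_prod (fun j _ => by norm_num) fun j _ => ?_
  have hua : ‖(q : ℂ) ^ (-a j)‖ ≤ 1 := norm_natCast_cpow_neg_le_one hpos (hab j).1
  have hvb : ‖(q : ℂ) ^ (-b j)‖ ≤ 1 := norm_natCast_cpow_neg_le_one hpos (hab j).2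
  have hu : ‖(q : ℂ) ^ (-a j) / q‖ ≤ 1 / 2 := by
    rw [norm_div, hnq, div_eq_mul_inv]
    exact (mul_le_of_le_one_left (by positivity) hua).trans hinv
  have hv : ‖(q : ℂ) ^ (-b j) / q‖ ≤ 1 / 2 := by
    rw [norm_div, hnq, div_eq_mul_inv]
    exact (mul_le_of_le_one_left (by positivity) hvb).trans hinv
  have hw : ‖(q : ℂ) ^ (-a j) * (q : ℂ) ^ (-b j) / q‖ ≤ 1 / 2 := by
    rw [norm_div, norm_mul, hnq, div_eq_mul_inv]
    refine (mul_le_of_le_one_left (by positivity) ?_).trans hinv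
    calc ‖(q : ℂ) ^ (-a j)‖ * ‖(q : ℂ) ^ (-b j)‖ ≤ 1 * 1 :=
        mul_le_mul hua hvb (norm_nonneg _) zero_le_one
      _ = 1 := one_mul 1
  have h1 : (1 : ℝ) / 2 ≤ ‖1 - (q : ℂ) ^ (-a j) / q‖ := by
    have := norm_sub_norm_le (1 : ℂ) ((q : ℂ) ^ (-a j) / q); rw [norm_one] at this; linarith
  have h2 : (1 : ℝ) / 2 ≤ ‖1 - (q : ℂ) ^ (-b j) / q‖ := by
    have := norm_sub_norm_le (1 : ℂ) ((q : ℂ) ^ (-b j) / q); rw [norm_one] at this; linarith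
  have h3 : (2 : ℝ) / 3 ≤ ‖(1 - (q : ℂ) ^ (-a j) * (q : ℂ) ^ (-b j) / q)⁻¹‖ := by
    rw [norm_inv]
    have hle : ‖1 - (q : ℂ) ^ (-a j) * (q : ℂ) ^ (-b j) / q‖ ≤ 3 / 2 := by
      refine (norm_sub_le _ _).trans ?_; rw [norm_one]; linarith
    have hpos' : 0 < ‖1 - (q : ℂ) ^ (-a j) * (q : ℂ) ^ (-b j) / q‖ := by
      have := norm_sub_norm_le (1 : ℂ) ((q : ℂ) ^ (-a j) * (q : ℂ) ^ (-b j) / q)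
      rw [norm_one] at this; linarith
    rw [le_inv_comm₀ (by norm_num) hpos']
    linarith
  rw [norm_mul, norm_mul]
  calc (1 : ℝ) / 6 = (1 / 2) * (1 / 2) * (2 / 3) := by norm_num
    _ ≤ _ := by
        refine mul_le_mul (mul_le_mul h1 h2 (by norm_num) (norm_nonneg _)) h3 (by norm_num) ?_
        positivity

/-- `B_p ≠ 0`. [folklore] -/
theorem zetaFactor_ne_zero {a b : ι → ℂ} (hab : ∀ j, 0 ≤ (a j).re ∧ 0 ≤ (b j).re)
    {q : ℕ} (hq : 2 ≤ q) : zetaFactor a b q ≠ 0 := by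
  intro h
  have := norm_zetaFactor_ge hab hq
  rw [h, norm_zero] at this
  exact absurd this (not_le.2 (by positivity))

/-- The relative error `ε_p := K_p/B_p - 1` of (kp-est). [cite: Polymath8b2014, Lemma 4.1 (proof, (kp-est))] -/
def localEps (w : ℕ → ℂ) (a b : ι → ℂ) (q : ℕ) : ℂ := localFactor w a b q / zetaFactor a b q - 1

/-- The constant `C(k) = 6^k (49k² + 14k)` in `|ε_p| ≤ C(k)/p²`. [folklore] -/
def epsConst (k : ℕ) : ℝ := 6 ^ k * (49 * (k : ℝ) ^ 2 + 14 * k)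

omit [Fintype ι] in
/-- `C(k) ≥ 0`. [folklore] -/
theorem epsConst_nonneg (k : ℕ) : 0 ≤ epsConst k := by unfold epsConst; positivity

/-- `K_p = (1 + ε_p) B_p`. [cite: Polymath8b2014, Lemma 4.1 (proof, (kp-est))] -/
theorem localFactor_eq (w : ℕ → ℂ) {a b : ι → ℂ} (hab : ∀ j, 0 ≤ (a j).re ∧ 0 ≤ (b j).re)
    {q : ℕ} (hq : 2 ≤ q) : localFactor w a b q = (1 + localEps w a b q) * zetaFactor a b q := by
  rw [localEps, add_sub_cancel, div_mul_cancel₀ _ (zetaFactor_ne_zero hab hq)]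

/-- **(kp-est)**: `|ε_p| ≤ C(k)/p²` for `p ≥ 7k`. [cite: Polymath8b2014, Lemma 4.1 (proof, (kp-est))] -/
theorem norm_localEps_le {w : ℕ → ℂ} (hw : IsLcmWeight w) {a b : ι → ℂ}
    (hab : ∀ j, 0 ≤ (a j).re ∧ 0 ≤ (b j).re) {q : ℕ} (hqp : q.Prime) (hqk : 7 * Fintype.card ι ≤ q) :
    ‖localEps w a b q‖ ≤ epsConst (Fintype.card ι) / (q : ℝ) ^ 2 := by
  have hq := hqp.two_le
  have hz := zetaFactor_ne_zero hab hq
  have hzn : 0 < ‖zetaFactor a b q‖ := norm_pos_iff.2 hz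
  have e : localEps w a b q = (localFactor w a b q - zetaFactor a b q) / zetaFactor a b q := by
    rw [localEps]; field_simp
  rw [e, norm_div, div_le_iff₀ hzn]
  refine (norm_localFactor_sub_zetaFactor_le hw hab hqp hqk).trans ?_
  have hge := norm_zetaFactor_ge hab hq
  rw [epsConst]
  have h6 : (0 : ℝ) < (1 / 6) ^ Fintype.card ι := by positivity
  calc (49 * (Fintype.card ι : ℝ) ^ 2 + 14 * Fintype.card ι) / (q : ℝ) ^ 2
      = 6 ^ Fintype.card ι * (49 * (Fintype.card ι : ℝ) ^ 2 + 14 * Fintype.card ι) / (q : ℝ) ^ 2 *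
          (1 / 6) ^ Fintype.card ι := by
        rw [one_div, inv_pow]; field_simp
    _ ≤ _ := by gcongr

/-! ### The infinite product `E = ∏_{p ∤ W} (1 + ε_p)` -/

/-- `ε'_n := ε_n` for primes `n ∤ W`, `0` otherwise. [folklore] -/
def epsSeq (w : ℕ → ℂ) (W : ℕ) (a b : ι → ℂ) (n : ℕ) : ℂ :=
  if n.Prime ∧ ¬ n ∣ W then localEps w a b n else 0

/-- `E := ∏_{p ∤ W} (1 + ε_p)`, the factor `∏_{p : p > w} (1 + O(1/p²)) = 1 + o(1)` of the proof of
Lemma 4.1 (p. 12). [cite: Polymath8b2014, Lemma 4.1 (proof, p. 12)] -/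
def epsProd (w : ℕ → ℂ) (W : ℕ) (a b : ι → ℂ) : ℂ := ∏' n : ℕ, (1 + epsSeq w W a b n)

section Eps

variable {w : ℕ → ℂ} (hw : IsLcmWeight w) {W m : ℕ} {a b : ι → ℂ}
  (hab : ∀ j, 0 ≤ (a j).re ∧ 0 ≤ (b j).re)
  (hm2 : 2 ≤ m) (hmk : 7 * Fintype.card ι ≤ m) (hWm : ∀ q : ℕ, q.Prime → ¬ q ∣ W → m ≤ q)
include hw hab hm2 hmk hWm

omit hm2 in
/-- `|ε'_n| ≤ C(k)/n²` on `n ≥ m`, and `ε'_n = 0` for `n < m`. [folklore] -/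
theorem norm_epsSeq_le (n : ℕ) :
    ‖epsSeq w W a b n‖ ≤ if m ≤ n then epsConst (Fintype.card ι) / (n : ℝ) ^ 2 else 0 := by
  unfold epsSeq
  by_cases hn : n.Prime ∧ ¬ n ∣ W
  · have hmn : m ≤ n := hWm n hn.1 hn.2
    rw [if_pos hn, if_pos hmn]
    exact norm_localEps_le hw hab hn.1 (hmk.trans hmn)
  · rw [if_neg hn, norm_zero]
    split_ifs <;> first | positivity | exact (div_nonneg (epsConst_nonneg _) (by positivity))

/-- Partial sums of `|ε'_n|` are at most `2C(k)/m`. [folklore] -/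
theorem sum_norm_epsSeq_le (s : Finset ℕ) :
    ∑ n ∈ s, ‖epsSeq w W a b n‖ ≤ 2 * epsConst (Fintype.card ι) / m := by
  classical
  have hC := epsConst_nonneg (Fintype.card ι)
  set N := s.sup id + 1 with hN
  have hsub : s.filter (fun n => m ≤ n) ⊆ Finset.Ioo (m - 1) N := by
    intro n hn
    rw [Finset.mem_filter] at hn
    rw [Finset.mem_Ioo]
    have : n ≤ s.sup id := Finset.le_sup (f := id) hn.1
    omega
  calc ∑ n ∈ s, ‖epsSeq w W a b n‖
      ≤ ∑ n ∈ s, (if m ≤ n then epsConst (Fintype.card ι) / (n : ℝ) ^ 2 else 0) :=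
        Finset.sum_le_sum fun n _ => norm_epsSeq_le hw hab hmk hWm n
    _ = ∑ n ∈ s.filter (fun n => m ≤ n), epsConst (Fintype.card ι) / (n : ℝ) ^ 2 := by
        rw [Finset.sum_filter]
    _ ≤ ∑ n ∈ Finset.Ioo (m - 1) N, epsConst (Fintype.card ι) / (n : ℝ) ^ 2 :=
        Finset.sum_le_sum_of_subset_of_nonneg hsub fun n _ _ => by positivity
    _ = epsConst (Fintype.card ι) * ∑ n ∈ Finset.Ioo (m - 1) N, ((n : ℝ) ^ 2)⁻¹ := by
        rw [Finset.mul_sum]; exact Finset.sum_congr rfl fun n _ => by rw [div_eq_mul_inv]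
    _ ≤ epsConst (Fintype.card ι) * (2 / ((m - 1 : ℕ) + 1)) :=
        mul_le_mul_of_nonneg_left (sum_Ioo_inv_sq_le _ _) hC
    _ = 2 * epsConst (Fintype.card ι) / m := by
        have : ((m - 1 : ℕ) : ℝ) + 1 = m := by
          rw [Nat.cast_sub (by omega : 1 ≤ m)]; push_cast; ring
        rw [this]; ring

/-- `∑ |ε'_n| < ∞`. [folklore] -/
theorem summable_norm_epsSeq : Summable fun n => ‖epsSeq w W a b n‖ :=
  summable_of_sum_le (fun _ => norm_nonneg _) (sum_norm_epsSeq_le hw hab hm2 hmk hWm)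

/-- The partial products `∏_{p < N, p ∤ W} (1 + ε_p)` tend to `E`. [folklore] -/
theorem tendsto_prod_one_add_localEps :
    Tendsto (fun N : ℕ => ∏ q ∈ primesBelowNotDvd W N, (1 + localEps w a b q)) atTop
      (𝓝 (epsProd w W a b)) := by
  have hmul : Multipliable fun n => 1 + epsSeq w W a b n :=
    Complex.multipliable_one_add_of_summable (summable_norm_epsSeq hw hab hm2 hmk hWm).of_norm
  have h := hmul.hasProd.tendsto_prod_nat
  refine h.congr fun N => ?_
  rw [primesBelowNotDvd, Nat.primesBelow, Finset.filter_filter, Finset.prod_filter]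
  refine Finset.prod_congr rfl fun n _ => ?_
  unfold epsSeq
  split_ifs <;> simp

/-- `‖∏_{p < N, p ∤ W} (1 + ε_p)‖ ≤ exp(2C(k)/m)`. [folklore] -/
theorem norm_prod_one_add_localEps_le (N : ℕ) :
    ‖∏ q ∈ primesBelowNotDvd W N, (1 + localEps w a b q)‖ ≤
      Real.exp (2 * epsConst (Fintype.card ι) / m) := by
  refine (norm_prod_one_add_le_exp _ _).trans (Real.exp_le_exp.2 ?_)
  have h := sum_norm_epsSeq_le hw hab hm2 hmk hWm (primesBelowNotDvd W N)
  refine le_trans (le_of_eq ?_) h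
  refine Finset.sum_congr rfl fun q hq => ?_
  rw [epsSeq, if_pos ⟨prime_of_mem_primesBelowNotDvd hq, not_dvd_of_mem_primesBelowNotDvd hq⟩]

/-- `‖∏_{p < N, p ∤ W} (1 + ε_p) - 1‖ ≤ exp(2C(k)/m) - 1`. [folklore] -/
theorem norm_prod_one_add_localEps_sub_one_le (N : ℕ) :
    ‖∏ q ∈ primesBelowNotDvd W N, (1 + localEps w a b q) - 1‖ ≤
      Real.exp (2 * epsConst (Fintype.card ι) / m) - 1 := by
  refine (Finset.norm_prod_one_add_sub_one_le _ _).trans ?_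
  have h := sum_norm_epsSeq_le hw hab hm2 hmk hWm (primesBelowNotDvd W N)
  have h' : ∑ q ∈ primesBelowNotDvd W N, ‖localEps w a b q‖ =
      ∑ q ∈ primesBelowNotDvd W N, ‖epsSeq w W a b q‖ :=
    Finset.sum_congr rfl fun q hq => by
      rw [epsSeq, if_pos ⟨prime_of_mem_primesBelowNotDvd hq, not_dvd_of_mem_primesBelowNotDvd hq⟩]
  rw [h']
  linarith [Real.exp_le_exp.2 h]

/-- **`∏_{p > w} (1 + O(1/p²)) = 1 + o(1)`, quantitatively**: `‖E‖ ≤ exp(2C(k)/m)` and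
`‖E - 1‖ ≤ exp(2C(k)/m) - 1` when all primes not dividing `W` are `≥ m`.
[cite: Polymath8b2014, Lemma 4.1 (proof, p. 12)] -/
theorem norm_epsProd_le : ‖epsProd w W a b‖ ≤ Real.exp (2 * epsConst (Fintype.card ι) / m) :=
  le_of_tendsto' ((continuous_norm.tendsto _).comp (tendsto_prod_one_add_localEps hw hab hm2 hmk hWm))
    fun N => norm_prod_one_add_localEps_le hw hab hm2 hmk hWm N

/-- `‖E - 1‖ ≤ exp(2C(k)/m) - 1` (see `norm_epsProd_le`). [cite: Polymath8b2014, Lemma 4.1 (proof, p. 12)] -/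
theorem norm_epsProd_sub_one_le :
    ‖epsProd w W a b - 1‖ ≤ Real.exp (2 * epsConst (Fintype.card ι) / m) - 1 :=
  le_of_tendsto' ((continuous_norm.tendsto _).comp
    ((tendsto_prod_one_add_localEps hw hab hm2 hmk hWm).sub_const 1))
    fun N => norm_prod_one_add_localEps_sub_one_le hw hab hm2 hmk hWm N

end Eps

/-! ### The modified zeta function `ζ_W` and the Euler products over `p ∤ W` -/

/-- `ζ_W(s) := ∏_{p ∤ W} (1 - p^{-s})^{-1} = ζ(s) ∏_{p ∣ W} (1 - p^{-s})` (`Re s > 1`), the modified zeta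
function of the proof of Lemma 4.1 (with `N = 1`).

Library note: for `W ≠ 0` and `s ≠ 1` this is Mathlib's `L`-function of the trivial character mod `W`,
`DirichletCharacter.LFunctionTrivChar W s` (`zetaW_eq_LFunctionTrivChar`, from
`DirichletCharacter.LFunctionTrivChar_eq_mul_riemannZeta`).  The explicit product is kept as a thin
abbreviation, total in `W` (no `NeZero W` instance to thread through `polymathW x`) and with the
finite product over `W.primeFactors` syntactically available: the downstream files rewrite with it
(`rw [zetaW]` in `PolymathLcmSumsProofs.lean`, factor-by-factor comparison with `φ(W)/W` in
`exists_prod_primeFactors_eq`) and obtain its Euler product over `p ∤ W` directly from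
`riemannZeta_eulerProduct` (`tendsto_prod_inv_primesBelowNotDvd`).
[cite: Polymath8b2014, Lemma 4.1 (proof, definition of ζ_{WN})] -/
def zetaW (W : ℕ) (s : ℂ) : ℂ := riemannZeta s * ∏ p ∈ W.primeFactors, (1 - (p : ℂ) ^ (-s))

omit [Fintype ι] in
/-- **Bridge to Mathlib**: `ζ_W(s) = L(s, 1_W)`, the `L`-function of the trivial Dirichlet character
mod `W` (`DirichletCharacter.LFunctionTrivChar`), for `W ≠ 0`, `s ≠ 1`. [folklore] -/
theorem zetaW_eq_LFunctionTrivChar {W : ℕ} [NeZero W] {s : ℂ} (hs : s ≠ 1) :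
    zetaW W s = DirichletCharacter.LFunctionTrivChar W s := by
  rw [DirichletCharacter.LFunctionTrivChar_eq_mul_riemannZeta hs, zetaW, mul_comm]

omit [Fintype ι] in
/-- `|p^{-s}| < 1` for `p ≥ 2`, `Re s > 0`. [folklore] -/
theorem norm_natCast_cpow_neg_lt_one {q : ℕ} (hq : 2 ≤ q) {s : ℂ} (hs : 0 < s.re) :
    ‖(q : ℂ) ^ (-s)‖ < 1 := by
  rw [Complex.norm_natCast_cpow_of_pos (by omega), Complex.neg_re]
  exact Real.rpow_lt_one_of_one_lt_of_neg (by exact_mod_cast hq) (by linarith)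

omit [Fintype ι] in
/-- `1 - p^{-s} ≠ 0` for `p ≥ 2`, `Re s > 0`. [folklore] -/
theorem one_sub_cpow_ne_zero {q : ℕ} (hq : 2 ≤ q) {s : ℂ} (hs : 0 < s.re) :
    (1 - (q : ℂ) ^ (-s)) ≠ 0 := by
  intro h
  have h1 : (q : ℂ) ^ (-s) = 1 := by linear_combination -h
  have := norm_natCast_cpow_neg_lt_one hq hs
  rw [h1, norm_one] at this
  exact lt_irrefl _ this

omit [Fintype ι] in
/-- `ζ_W(s) ≠ 0` for `Re s > 1`. [folklore] -/
theorem zetaW_ne_zero {W : ℕ} {s : ℂ} (hs : 1 < s.re) : zetaW W s ≠ 0 := by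
  refine mul_ne_zero (riemannZeta_ne_zero_of_one_lt_re hs) (Finset.prod_ne_zero_iff.2 fun p hp => ?_)
  exact one_sub_cpow_ne_zero (Nat.prime_of_mem_primeFactors hp).two_le (by linarith)

omit [Fintype ι] in
/-- For `N > W ≠ 0`, `primesBelow N` splits into the primes not dividing `W` and the prime factors of
`W`. [folklore] -/
theorem primesBelow_eq_union {W N : ℕ} (hW : W ≠ 0) (hN : W < N) :
    Nat.primesBelow N = primesBelowNotDvd W N ∪ W.primeFactors := by
  ext q
  simp only [Finset.mem_union, primesBelowNotDvd, Finset.mem_filter, Nat.mem_primesBelow,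
    Nat.mem_primeFactors]
  constructor
  · rintro ⟨hqN, hq⟩
    by_cases hqW : q ∣ W
    · exact Or.inr ⟨hq, hqW, hW⟩
    · exact Or.inl ⟨⟨hqN, hq⟩, hqW⟩
  · rintro (⟨⟨hqN, hq⟩, _⟩ | ⟨hq, hqW, _⟩)
    · exact ⟨hqN, hq⟩
    · exact ⟨lt_of_le_of_lt (Nat.le_of_dvd (Nat.pos_of_ne_zero hW) hqW) hN, hq⟩

omit [Fintype ι] in
/-- The primes not dividing `W` are disjoint from the prime factors of `W`. [folklore] -/
theorem disjoint_primesBelowNotDvd_primeFactors (W N : ℕ) :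
    Disjoint (primesBelowNotDvd W N) W.primeFactors := by
  rw [Finset.disjoint_left]
  intro q hq hq'
  exact not_dvd_of_mem_primesBelowNotDvd hq (Nat.dvd_of_mem_primeFactors hq')

omit [Fintype ι] in
/-- **Euler product of `ζ_W`**: `∏_{p < N, p ∤ W} (1 - p^{-s})^{-1} → ζ_W(s)` (`Re s > 1`), from
Mathlib's Euler product for `ζ`. [cite: Polymath8b2014, Lemma 4.1 (proof, definition of ζ_{WN})] -/
theorem tendsto_prod_inv_primesBelowNotDvd {W : ℕ} (hW : W ≠ 0) {s : ℂ} (hs : 1 < s.re) :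
    Tendsto (fun N : ℕ => ∏ q ∈ primesBelowNotDvd W N, (1 - (q : ℂ) ^ (-s))⁻¹) atTop
      (𝓝 (zetaW W s)) := by
  have hF : ∀ p ∈ W.primeFactors, (1 - (p : ℂ) ^ (-s))⁻¹ ≠ 0 := fun p hp =>
    inv_ne_zero (one_sub_cpow_ne_zero (Nat.prime_of_mem_primeFactors hp).two_le (by linarith))
  set F : ℂ := ∏ p ∈ W.primeFactors, (1 - (p : ℂ) ^ (-s))⁻¹ with hFdef
  have hF0 : F ≠ 0 := Finset.prod_ne_zero_iff.2 hF
  have hz := riemannZeta_eulerProduct hs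
  have hev : (fun N : ℕ => ∏ q ∈ primesBelowNotDvd W N, (1 - (q : ℂ) ^ (-s))⁻¹) =ᶠ[atTop]
      fun N => (∏ p ∈ Nat.primesBelow N, (1 - (p : ℂ) ^ (-s))⁻¹) * F⁻¹ := by
    filter_upwards [eventually_gt_atTop W] with N hN
    rw [primesBelow_eq_union hW hN, Finset.prod_union (disjoint_primesBelowNotDvd_primeFactors W N),
      ← hFdef, mul_inv_cancel_right₀ hF0]
  refine Tendsto.congr' hev.symm ?_
  have hlim : zetaW W s = riemannZeta s * F⁻¹ := by
    rw [zetaW, hFdef, Finset.prod_inv_distrib]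
    simp only [inv_inv]
  rw [hlim]
  exact hz.mul_const _

omit [Fintype ι] in
/-- `∏_{p < N, p ∤ W} (1 - p^{-s}) → ζ_W(s)^{-1}`. [folklore] -/
theorem tendsto_prod_primesBelowNotDvd {W : ℕ} (hW : W ≠ 0) {s : ℂ} (hs : 1 < s.re) :
    Tendsto (fun N : ℕ => ∏ q ∈ primesBelowNotDvd W N, (1 - (q : ℂ) ^ (-s))) atTop
      (𝓝 (zetaW W s)⁻¹) := by
  have h := (tendsto_prod_inv_primesBelowNotDvd hW hs).inv₀ (zetaW_ne_zero hs)
  refine h.congr fun N => ?_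
  rw [Finset.prod_inv_distrib, inv_inv]

/-- The limit `Z := ∏_j ζ_W(1+a_j+b_j) / (ζ_W(1+a_j) ζ_W(1+b_j))` of the `ζ`-side Euler products.
[cite: Polymath8b2014, Lemma 4.1 (proof, display after (kp-est))] -/
def zetaLimit (W : ℕ) (a b : ι → ℂ) : ℂ :=
  ∏ j, zetaW W (1 + a j + b j) / (zetaW W (1 + a j) * zetaW W (1 + b j))

omit [Fintype ι] in
/-- `p^{-a}/p = p^{-(1+a)}`. [folklore] -/
theorem cpow_neg_div_natCast {q : ℕ} (hq : q ≠ 0) (a : ℂ) :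
    (q : ℂ) ^ (-a) / q = (q : ℂ) ^ (-(1 + a)) := by
  have hqc : (q : ℂ) ≠ 0 := by exact_mod_cast hq
  rw [neg_add, Complex.cpow_add _ _ hqc, Complex.cpow_neg_one, div_eq_mul_inv, mul_comm]

omit [Fintype ι] in
/-- `p^{-a} p^{-b}/p = p^{-(1+a+b)}`. [folklore] -/
theorem cpow_neg_mul_cpow_neg_div_natCast {q : ℕ} (hq : q ≠ 0) (a b : ℂ) :
    (q : ℂ) ^ (-a) * (q : ℂ) ^ (-b) / q = (q : ℂ) ^ (-(1 + a + b)) := by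
  have hqc : (q : ℂ) ≠ 0 := by exact_mod_cast hq
  rw [show -(1 + a + b) = (-1) + ((-a) + (-b)) by ring, Complex.cpow_add _ _ hqc,
    Complex.cpow_add _ _ hqc, Complex.cpow_neg_one, div_eq_mul_inv]
  ring

/-- **`∏_{p < N, p ∤ W} B_p → Z`** ("`K = (1+o(1)) ∏_j ζ_{WN}(1 + (2+iξ_j+iξ'_j)/log x) / (ζ_{WN}(1 + (1+iξ_j)/log x) ζ_{WN}(1 + (1+iξ'_j)/log x))`",
p. 12). [cite: Polymath8b2014, Lemma 4.1 (proof, p. 12)] -/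
theorem tendsto_prod_zetaFactor {W : ℕ} (hW : W ≠ 0) {a b : ι → ℂ}
    (hab : ∀ j, 0 < (a j).re ∧ 0 < (b j).re) :
    Tendsto (fun N : ℕ => ∏ q ∈ primesBelowNotDvd W N, zetaFactor a b q) atTop
      (𝓝 (zetaLimit W a b)) := by
  -- rewrite the finite products index by index
  have hre : ∀ N, ∏ q ∈ primesBelowNotDvd W N, zetaFactor a b q =
      ∏ j, ((∏ q ∈ primesBelowNotDvd W N, (1 - (q : ℂ) ^ (-(1 + a j)))) *
        (∏ q ∈ primesBelowNotDvd W N, (1 - (q : ℂ) ^ (-(1 + b j)))) *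
        (∏ q ∈ primesBelowNotDvd W N, (1 - (q : ℂ) ^ (-(1 + a j + b j))))⁻¹) := by
    intro N
    simp only [zetaFactor]
    rw [Finset.prod_comm]
    refine Finset.prod_congr rfl fun j _ => ?_
    rw [← Finset.prod_inv_distrib, ← Finset.prod_mul_distrib, ← Finset.prod_mul_distrib]
    refine Finset.prod_congr rfl fun q hq => ?_
    have hq0 : q ≠ 0 := (prime_of_mem_primesBelowNotDvd hq).ne_zero
    rw [cpow_neg_div_natCast hq0, cpow_neg_div_natCast hq0, cpow_neg_mul_cpow_neg_div_natCast hq0]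
  simp_rw [hre]
  refine tendsto_finsetProd _ fun j _ => ?_
  have ha : 1 < (1 + a j).re := by simp; exact (hab j).1
  have hb : 1 < (1 + b j).re := by simp; exact (hab j).2
  have hab' : 1 < (1 + a j + b j).re := by simp; linarith [(hab j).1, (hab j).2]
  have h := ((tendsto_prod_primesBelowNotDvd hW ha).mul (tendsto_prod_primesBelowNotDvd hW hb)).mul
    (tendsto_prod_inv_primesBelowNotDvd hW hab')
  refine (h.congr fun N => ?_).trans ?_
  · rw [Finset.prod_inv_distrib]
  · rw [div_eq_mul_inv, mul_inv, mul_comm]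

/-! ### `K = E · Z` -/

/-- **The kernel against `ζ`**: `K = E · ∏_j ζ_W(1+a_j+b_j)/(ζ_W(1+a_j)ζ_W(1+b_j))` with
`E = ∏_{p ∤ W}(1 + ε_p)` (Polymath 8b p. 12: "`K = (1+o(1)) ∏_j ζ_{WN}(…)/(ζ_{WN}(…)ζ_{WN}(…))`";
the `o(1)` is made explicit by `norm_epsProd_sub_one_le`). [cite: Polymath8b2014, Lemma 4.1 (proof, p. 12)] -/
theorem eulerKernel_eq_epsProd_mul_zetaLimit [DecidableEq ι] {w : ℕ → ℂ} (hw : IsLcmWeight w)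
    {W m : ℕ} (hW : W ≠ 0) {a b : ι → ℂ} {σ : ℝ} (hσ : 0 < σ) (hab : ∀ j, (a j).re = σ ∧ (b j).re = σ)
    (hm2 : 2 ≤ m) (hmk : 7 * Fintype.card ι ≤ m) (hWm : ∀ q : ℕ, q.Prime → ¬ q ∣ W → m ≤ q) :
    eulerKernel w W a b = epsProd w W a b * zetaLimit W a b := by
  have hab0 : ∀ j, 0 ≤ (a j).re ∧ 0 ≤ (b j).re := fun j => by
    rw [(hab j).1, (hab j).2]; exact ⟨hσ.le, hσ.le⟩
  have habp : ∀ j, 0 < (a j).re ∧ 0 < (b j).re := fun j => by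
    rw [(hab j).1, (hab j).2]; exact ⟨hσ, hσ⟩
  have h1 := tendsto_prod_localFactor hw (W := W) hσ hab
  have h2 := (tendsto_prod_one_add_localEps hw hab0 hm2 hmk hWm).mul (tendsto_prod_zetaFactor hW habp)
  have heq : (fun N : ℕ => ∏ q ∈ primesBelowNotDvd W N, localFactor w a b q) =
      fun N => (∏ q ∈ primesBelowNotDvd W N, (1 + localEps w a b q)) *
        ∏ q ∈ primesBelowNotDvd W N, zetaFactor a b q := by
    funext N
    rw [← Finset.prod_mul_distrib]
    exact Finset.prod_congr rfl fun q hq =>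
      localFactor_eq w hab0 (prime_of_mem_primesBelowNotDvd hq).two_le
  rw [heq] at h1
  exact tendsto_nhds_unique h1 h2

/-! ### Crude bounds: `|ζ_W(s)|^{±1} ≤ ζ(1 + 1/log x)` (p. 12) -/

/-- `‖ζ(s)‖` for real `s`, the bound for the Euler products on the line `Re = s`. [folklore] -/
def zetaR (s : ℝ) : ℝ := ‖riemannZeta (s : ℂ)‖

omit [Fintype ι] in
/-- `zetaR s ≥ 0`. [folklore] -/
theorem zetaR_nonneg (s : ℝ) : 0 ≤ zetaR s := norm_nonneg _

omit [Fintype ι] in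
/-- For real `s > 0` and `q ≥ 2`: `0 ≤ q^{-s} < 1`. [folklore] -/
theorem rpow_neg_lt_one {q : ℕ} (hq : 2 ≤ q) {s : ℝ} (hs : 0 < s) :
    0 ≤ (q : ℝ) ^ (-s) ∧ (q : ℝ) ^ (-s) < 1 :=
  ⟨Real.rpow_nonneg (Nat.cast_nonneg q) _,
    Real.rpow_lt_one_of_one_lt_of_neg (by exact_mod_cast hq) (by linarith)⟩

omit [Fintype ι] in
/-- Enlarging a product of reals by factors `≥ 1`. [folklore] -/
theorem prod_le_prod_of_subset_of_one_le_real {s t : Finset ℕ} (h : s ⊆ t) {f : ℕ → ℝ}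
    (h0 : ∀ i ∈ s, 0 ≤ f i) (h1 : ∀ i ∈ t, i ∉ s → 1 ≤ f i) :
    ∏ i ∈ s, f i ≤ ∏ i ∈ t, f i := by
  classical
  rw [← Finset.prod_sdiff h]
  have hge : 1 ≤ ∏ i ∈ t \ s, f i := by
    have h2 : ∏ _i ∈ t \ s, (1 : ℝ) ≤ ∏ i ∈ t \ s, f i :=
      Finset.prod_le_prod (fun _ _ => zero_le_one) fun i hi =>
        h1 i (Finset.mem_sdiff.1 hi).1 (Finset.mem_sdiff.1 hi).2
    simpa using h2
  exact le_mul_of_one_le_left (Finset.prod_nonneg h0) hge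

omit [Fintype ι] in
/-- **The Euler product bound** `∏_{p < N} (1 - p^{-s})^{-1} ≤ ζ(s)` for real `s > 1` (the partial
products increase to `ζ(s)`). [cite: Polymath8b2014, Lemma 4.1 (proof, p. 12: "comparing the factors in the Euler product")] -/
theorem prod_primesBelow_inv_le_zetaR {s : ℝ} (hs : 1 < s) (N : ℕ) :
    ∏ q ∈ Nat.primesBelow N, (1 - (q : ℝ) ^ (-s))⁻¹ ≤ zetaR s := by
  set r : ℕ → ℝ := fun N => ∏ q ∈ Nat.primesBelow N, (1 - (q : ℝ) ^ (-s))⁻¹ with hr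
  have hfac : ∀ M, ∀ q ∈ Nat.primesBelow M, 1 ≤ (1 - (q : ℝ) ^ (-s))⁻¹ := by
    intro M q hq
    have h := rpow_neg_lt_one (Nat.mem_primesBelow.1 hq).2.two_le (by linarith : 0 < s)
    rw [one_le_inv₀ (by linarith)]; linarith
  have hmono : Monotone r := fun N M hNM =>
    prod_le_prod_of_subset_of_one_le_real (Nat.primesBelow_mono hNM)
      (fun q hq => zero_le_one.trans (hfac N q hq)) fun q hq _ => hfac M q hq
  have hnonneg : ∀ N, 0 ≤ r N := fun N =>
    Finset.prod_nonneg fun q hq => zero_le_one.trans (hfac N q hq)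
  have hcast : ∀ N, ((r N : ℝ) : ℂ) = ∏ q ∈ Nat.primesBelow N, (1 - (q : ℂ) ^ (-(s : ℂ)))⁻¹ := by
    intro N
    rw [hr]; push_cast
    refine Finset.prod_congr rfl fun q _ => ?_
    rw [Complex.ofReal_cpow (Nat.cast_nonneg q)]; push_cast; rfl
  have hz := riemannZeta_eulerProduct (s := (s : ℂ)) (by simpa using hs)
  have ht : Tendsto r atTop (𝓝 (zetaR s)) := by
    have h1 : Tendsto (fun N => ‖((r N : ℝ) : ℂ)‖) atTop (𝓝 (zetaR s)) := by
      simp_rw [hcast]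
      exact (continuous_norm.tendsto _).comp hz
    refine h1.congr fun N => ?_
    rw [Complex.norm_real, Real.norm_eq_abs, abs_of_nonneg (hnonneg N)]
  exact hmono.ge_of_tendsto ht N

omit [Fintype ι] in
/-- `∏_{p ∈ P} (1 - p^{-s})^{-1} ≤ ζ(s)` for any finite set of primes. [folklore] -/
theorem prod_inv_le_zetaR {s : ℝ} (hs : 1 < s) {P : Finset ℕ} (hP : ∀ q ∈ P, q.Prime) :
    ∏ q ∈ P, (1 - (q : ℝ) ^ (-s))⁻¹ ≤ zetaR s := by
  classical
  set N := P.sup id + 1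
  have hsub : P ⊆ Nat.primesBelow N := fun q hq =>
    Nat.mem_primesBelow.2 ⟨Nat.lt_succ_of_le (Finset.le_sup (f := id) hq), hP q hq⟩
  refine le_trans ?_ (prod_primesBelow_inv_le_zetaR hs N)
  have hfac : ∀ q ∈ Nat.primesBelow N, 1 ≤ (1 - (q : ℝ) ^ (-s))⁻¹ := fun q hq => by
    have h := rpow_neg_lt_one (Nat.mem_primesBelow.1 hq).2.two_le (by linarith : 0 < s)
    rw [one_le_inv₀ (by linarith)]; linarith
  exact prod_le_prod_of_subset_of_one_le_real hsub
    (fun q hq => zero_le_one.trans (hfac q (hsub hq))) fun q hq _ => hfac q hq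

omit [Fintype ι] in
/-- `∏_{p ∈ P} (1 + p^{-s}) ≤ ζ(s)` for any finite set of primes. [folklore] -/
theorem prod_one_add_le_zetaR {s : ℝ} (hs : 1 < s) {P : Finset ℕ} (hP : ∀ q ∈ P, q.Prime) :
    ∏ q ∈ P, (1 + (q : ℝ) ^ (-s)) ≤ zetaR s := by
  refine le_trans (Finset.prod_le_prod (fun q _ => by positivity) fun q hq => ?_) (prod_inv_le_zetaR hs hP)
  have h := rpow_neg_lt_one (hP q hq).two_le (by linarith : 0 < s)
  rw [inv_eq_one_div, le_div_iff₀ (by linarith)]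
  nlinarith

/-- `‖B_p‖ ≤ (1 + p^{-1-σ})² (1 - p^{-1-2σ})^{-1}` per index when `Re a_j = Re b_j = σ`. [folklore] -/
theorem norm_zetaFactor_le {a b : ι → ℂ} {σ : ℝ} (hσ : 0 < σ) (hab : ∀ j, (a j).re = σ ∧ (b j).re = σ)
    {q : ℕ} (hq : 2 ≤ q) :
    ‖zetaFactor a b q‖ ≤
      ((1 + (q : ℝ) ^ (-(1 + σ))) * (1 + (q : ℝ) ^ (-(1 + σ))) * (1 - (q : ℝ) ^ (-(1 + 2 * σ)))⁻¹) ^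
        Fintype.card ι := by
  have hpos : 0 < q := by omega
  have hq0 : (0 : ℝ) < q := by exact_mod_cast hpos
  have hnq : ‖(q : ℂ)‖ = q := Complex.norm_natCast q
  have hsplit1 : (q : ℝ) ^ (-(1 + σ)) = (q : ℝ) ^ (-σ) / q := by
    rw [neg_add, Real.rpow_add hq0, Real.rpow_neg_one, div_eq_mul_inv]; ring
  have hsplit2 : (q : ℝ) ^ (-(1 + 2 * σ)) = (q : ℝ) ^ (-σ) * (q : ℝ) ^ (-σ) / q := by
    rw [← Real.rpow_add hq0, neg_add, Real.rpow_add hq0, Real.rpow_neg_one, div_eq_mul_inv]; ring_nf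
  have hna : ∀ j, ‖(q : ℂ) ^ (-a j) / q‖ = (q : ℝ) ^ (-(1 + σ)) := fun j => by
    rw [norm_div, hnq, Complex.norm_natCast_cpow_of_pos hpos, Complex.neg_re, (hab j).1, hsplit1]
  have hnb : ∀ j, ‖(q : ℂ) ^ (-b j) / q‖ = (q : ℝ) ^ (-(1 + σ)) := fun j => by
    rw [norm_div, hnq, Complex.norm_natCast_cpow_of_pos hpos, Complex.neg_re, (hab j).2, hsplit1]
  have hnw : ∀ j, ‖(q : ℂ) ^ (-a j) * (q : ℂ) ^ (-b j) / q‖ = (q : ℝ) ^ (-(1 + 2 * σ)) := fun j => by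
    rw [norm_div, norm_mul, hnq, Complex.norm_natCast_cpow_of_pos hpos,
      Complex.norm_natCast_cpow_of_pos hpos, Complex.neg_re, Complex.neg_re, (hab j).1, (hab j).2,
      hsplit2]
  have hw1 := rpow_neg_lt_one hq (by linarith : 0 < 1 + 2 * σ)
  rw [zetaFactor, norm_prod, ← Finset.card_univ, ← Finset.prod_const]
  refine Finset.prod_le_prod (fun j _ => norm_nonneg _) fun j _ => ?_
  rw [norm_mul, norm_mul, norm_inv]
  have h1 : ‖1 - (q : ℂ) ^ (-a j) / q‖ ≤ 1 + (q : ℝ) ^ (-(1 + σ)) := by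
    rw [← hna j]; exact (norm_sub_le _ _).trans (by rw [norm_one])
  have h2 : ‖1 - (q : ℂ) ^ (-b j) / q‖ ≤ 1 + (q : ℝ) ^ (-(1 + σ)) := by
    rw [← hnb j]; exact (norm_sub_le _ _).trans (by rw [norm_one])
  have h3 : ‖1 - (q : ℂ) ^ (-a j) * (q : ℂ) ^ (-b j) / q‖⁻¹ ≤ (1 - (q : ℝ) ^ (-(1 + 2 * σ)))⁻¹ := by
    have hlow : 1 - (q : ℝ) ^ (-(1 + 2 * σ)) ≤ ‖1 - (q : ℂ) ^ (-a j) * (q : ℂ) ^ (-b j) / q‖ := by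
      rw [← hnw j]
      have := norm_sub_norm_le (1 : ℂ) ((q : ℂ) ^ (-a j) * (q : ℂ) ^ (-b j) / q)
      rwa [norm_one] at this
    exact inv_anti₀ (by linarith [hw1.2]) hlow
  exact mul_le_mul (mul_le_mul h1 h2 (norm_nonneg _) (by positivity)) h3 (by positivity) (by positivity)

/-- **`K = O(log^{3k} x)`, ζ-side**: `‖∏_{p < N, p ∤ W} B_p‖ ≤ (ζ(1+σ)² ζ(1+2σ))^k` and hence
`‖Z‖ ≤ (ζ(1+σ)² ζ(1+2σ))^k`. [cite: Polymath8b2014, Lemma 4.1 (proof, p. 12: "`K = O(log^{3k} x)`")] -/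
theorem norm_prod_zetaFactor_le {W : ℕ} {a b : ι → ℂ} {σ : ℝ} (hσ : 0 < σ)
    (hab : ∀ j, (a j).re = σ ∧ (b j).re = σ) (N : ℕ) :
    ‖∏ q ∈ primesBelowNotDvd W N, zetaFactor a b q‖ ≤
      (zetaR (1 + σ) ^ 2 * zetaR (1 + 2 * σ)) ^ Fintype.card ι := by
  have hP : ∀ q ∈ primesBelowNotDvd W N, q.Prime := fun q hq => prime_of_mem_primesBelowNotDvd hq
  rw [norm_prod]
  calc ∏ q ∈ primesBelowNotDvd W N, ‖zetaFactor a b q‖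
      ≤ ∏ q ∈ primesBelowNotDvd W N, ((1 + (q : ℝ) ^ (-(1 + σ))) * (1 + (q : ℝ) ^ (-(1 + σ))) *
          (1 - (q : ℝ) ^ (-(1 + 2 * σ)))⁻¹) ^ Fintype.card ι :=
        Finset.prod_le_prod (fun q _ => norm_nonneg _) fun q hq => norm_zetaFactor_le hσ hab (hP q hq).two_le
    _ = ((∏ q ∈ primesBelowNotDvd W N, (1 + (q : ℝ) ^ (-(1 + σ)))) *
          (∏ q ∈ primesBelowNotDvd W N, (1 + (q : ℝ) ^ (-(1 + σ)))) *
          ∏ q ∈ primesBelowNotDvd W N, (1 - (q : ℝ) ^ (-(1 + 2 * σ)))⁻¹) ^ Fintype.card ι := by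
        rw [Finset.prod_pow, Finset.prod_mul_distrib, Finset.prod_mul_distrib]
    _ ≤ (zetaR (1 + σ) * zetaR (1 + σ) * zetaR (1 + 2 * σ)) ^ Fintype.card ι := by
        have hA := prod_one_add_le_zetaR (by linarith : 1 < 1 + σ) hP
        have hC := prod_inv_le_zetaR (by linarith : 1 < 1 + 2 * σ) hP
        have hA0 : 0 ≤ ∏ q ∈ primesBelowNotDvd W N, (1 + (q : ℝ) ^ (-(1 + σ))) :=
          Finset.prod_nonneg fun q _ => by positivity
        have hC0 : 0 ≤ ∏ q ∈ primesBelowNotDvd W N, (1 - (q : ℝ) ^ (-(1 + 2 * σ)))⁻¹ :=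
          Finset.prod_nonneg fun q hq => by
            have := rpow_neg_lt_one (hP q hq).two_le (by linarith : 0 < 1 + 2 * σ)
            exact inv_nonneg.2 (by linarith [this.2])
        exact pow_le_pow_left₀ (mul_nonneg (mul_nonneg hA0 hA0) hC0)
          (mul_le_mul (mul_le_mul hA hA hA0 (zetaR_nonneg _)) hC hC0
            (mul_nonneg (zetaR_nonneg _) (zetaR_nonneg _))) _
    _ = _ := by ring

/-- `‖Z‖ ≤ (ζ(1+σ)² ζ(1+2σ))^k`. [cite: Polymath8b2014, Lemma 4.1 (proof, p. 12)] -/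
theorem norm_zetaLimit_le {W : ℕ} (hW : W ≠ 0) {a b : ι → ℂ} {σ : ℝ} (hσ : 0 < σ)
    (hab : ∀ j, (a j).re = σ ∧ (b j).re = σ) :
    ‖zetaLimit W a b‖ ≤ (zetaR (1 + σ) ^ 2 * zetaR (1 + 2 * σ)) ^ Fintype.card ι := by
  have habp : ∀ j, 0 < (a j).re ∧ 0 < (b j).re := fun j => by
    rw [(hab j).1, (hab j).2]; exact ⟨hσ, hσ⟩
  exact le_of_tendsto' ((continuous_norm.tendsto _).comp (tendsto_prod_zetaFactor hW habp))
    fun N => norm_prod_zetaFactor_le hσ hab N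

/-- **`K = O(log^{3k} x)`** (p. 12), in the form `‖K‖ ≤ exp(2C(k)/m) (ζ(1+σ)²ζ(1+2σ))^k`.
[cite: Polymath8b2014, Lemma 4.1 (proof, p. 12)] -/
theorem norm_eulerKernel_le_zeta [DecidableEq ι] {w : ℕ → ℂ} (hw : IsLcmWeight w) {W m : ℕ}
    (hW : W ≠ 0) {a b : ι → ℂ} {σ : ℝ} (hσ : 0 < σ) (hab : ∀ j, (a j).re = σ ∧ (b j).re = σ)
    (hm2 : 2 ≤ m) (hmk : 7 * Fintype.card ι ≤ m) (hWm : ∀ q : ℕ, q.Prime → ¬ q ∣ W → m ≤ q) :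
    ‖eulerKernel w W a b‖ ≤ Real.exp (2 * epsConst (Fintype.card ι) / m) *
      (zetaR (1 + σ) ^ 2 * zetaR (1 + 2 * σ)) ^ Fintype.card ι := by
  have hab0 : ∀ j, 0 ≤ (a j).re ∧ 0 ≤ (b j).re := fun j => by
    rw [(hab j).1, (hab j).2]; exact ⟨hσ.le, hσ.le⟩
  rw [eulerKernel_eq_epsProd_mul_zetaLimit hw hW hσ hab hm2 hmk hWm, norm_mul]
  exact mul_le_mul (norm_epsProd_le hw hab0 hm2 hmk hWm) (norm_zetaLimit_le hW hσ hab) (norm_nonneg _)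
    (by positivity)

/-! ### The simple pole: `(s-1)ζ(s) → 1` -/

omit [Fintype ι] in
/-- **The simple pole of `ζ` at `1`**, quantitatively: for every `ε > 0` there is `δ > 0` with
`‖s ζ(1+s) - 1‖ ≤ ε` for `0 < ‖s‖ < δ` ("from the simple pole of the Riemann zeta function at `s = 1`,
`ζ(1 + (1+iξ_j)/log x) = (1+o(1)) log x/(1+iξ_j)`", p. 12). [cite: Polymath8b2014, Lemma 4.1 (proof, p. 12)] -/
theorem exists_delta_zeta_pole {ε : ℝ} (hε : 0 < ε) :
    ∃ δ : ℝ, 0 < δ ∧ ∀ s : ℂ, s ≠ 0 → ‖s‖ < δ → ‖s * riemannZeta (1 + s) - 1‖ ≤ ε := by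
  have h := riemannZeta_residue_one
  rw [Metric.tendsto_nhdsWithin_nhds] at h
  obtain ⟨δ, hδ, hδ'⟩ := h ε hε
  refine ⟨δ, hδ, fun s hs hsδ => ?_⟩
  have h1 : (1 + s : ℂ) ∈ ({1}ᶜ : Set ℂ) := by
    simp only [Set.mem_compl_iff, Set.mem_singleton_iff, add_eq_left]; exact hs
  have h2 : dist (1 + s : ℂ) 1 < δ := by rw [dist_eq_norm]; simpa using hsδ
  have h3 := hδ' h1 h2
  rw [dist_eq_norm] at h3
  have e : (1 + s - 1) * riemannZeta (1 + s) - 1 = s * riemannZeta (1 + s) - 1 := by ring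
  rw [e] at h3
  exact h3.le

omit [Fintype ι] in
/-- `ζ(1+σ) ≤ 2/σ` for small `σ > 0` ("`ζ(1 + 1/log x) ≪ log x`", p. 12). [cite: Polymath8b2014, Lemma 4.1 (proof, p. 12)] -/
theorem exists_delta_zetaR_le :
    ∃ δ : ℝ, 0 < δ ∧ ∀ σ : ℝ, 0 < σ → σ < δ → zetaR (1 + σ) ≤ 2 / σ := by
  obtain ⟨δ, hδ, h⟩ := exists_delta_zeta_pole (ε := 1) one_pos
  refine ⟨δ, hδ, fun σ hσ hσδ => ?_⟩
  have hs : (σ : ℂ) ≠ 0 := by exact_mod_cast hσ.ne'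
  have hsn : ‖(σ : ℂ)‖ < δ := by rw [Complex.norm_real, Real.norm_eq_abs, abs_of_pos hσ]; exact hσδ
  have h1 := h σ hs hsn
  have h2 : ‖(σ : ℂ) * riemannZeta (1 + σ)‖ ≤ 2 := by
    have := norm_le_norm_add_norm_sub' ((σ : ℂ) * riemannZeta (1 + σ)) 1
    rw [norm_one] at this; linarith
  rw [norm_mul, Complex.norm_real, Real.norm_eq_abs, abs_of_pos hσ] at h2
  rw [zetaR, le_div_iff₀ hσ, mul_comm]
  push_cast
  exact h2

/-! ### `∏_{p ∣ W} (1 - p^{-1-s})` against `φ(W)/W` -/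

omit [Fintype ι] in
/-- `φ(W)/W = ∏_{p ∣ W} (1 - 1/p)`: the real form of Euler's product formula, cast from Mathlib's
`Nat.totient_eq_mul_prod_factors` (over `ℚ`). [folklore] -/
theorem totient_div_eq_prod {W : ℕ} (hW : W ≠ 0) :
    (Nat.totient W : ℝ) / W = ∏ p ∈ W.primeFactors, (1 - (p : ℝ)⁻¹) := by
  have hWq : (W : ℚ) ≠ 0 := by exact_mod_cast hW
  have h : ((Nat.totient W : ℚ) / W : ℚ) = ∏ p ∈ W.primeFactors, (1 - (p : ℚ)⁻¹) := by
    rw [Nat.totient_eq_mul_prod_factors, mul_div_cancel_left₀ _ hWq]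
  have h' := congrArg (Rat.cast : ℚ → ℝ) h
  push_cast at h'
  exact h'

omit [Fintype ι] in
/-- `‖1 - p^{-s}‖ ≤ 2 ‖s‖ log p` when `‖s‖ log p ≤ 1`. [folklore] -/
theorem norm_one_sub_cpow_neg_le {q : ℕ} (hq : 2 ≤ q) {s : ℂ} (hs : ‖s‖ * Real.log q ≤ 1) :
    ‖1 - (q : ℂ) ^ (-s)‖ ≤ 2 * (‖s‖ * Real.log q) := by
  have hqc : (q : ℂ) ≠ 0 := by exact_mod_cast (by omega : q ≠ 0)
  have hlog0 : 0 ≤ Real.log q := Real.log_nonneg (by exact_mod_cast (by omega : 1 ≤ q))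
  rw [Complex.cpow_def_of_ne_zero hqc, ← Complex.natCast_log, norm_sub_rev]
  have hz : ‖(Real.log q : ℂ) * -s‖ ≤ 1 := by
    rw [norm_mul, norm_neg, Complex.norm_real, Real.norm_eq_abs, abs_of_nonneg hlog0, mul_comm]
    exact hs
  refine (Complex.norm_exp_sub_one_le hz).trans (le_of_eq ?_)
  rw [norm_mul, norm_neg, Complex.norm_real, Real.norm_eq_abs, abs_of_nonneg hlog0]
  ring

omit [Fintype ι] in
/-- **`∏_{p ∣ W} (1 - p^{-1-s}) = (1+o(1)) φ(W)/W`** (p. 12, with `N = 1`), quantitatively: the ratio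
`ρ = ∏_{p ∣ W} (1 - p^{-1-s})/(1 - p^{-1})` differs from `1` by at most `exp(2‖s‖ ω(W)) - 1` as soon as
`‖s‖ log p ≤ 1` for all `p ∣ W`. [cite: Polymath8b2014, Lemma 4.1 (proof, p. 12)] -/
theorem exists_prod_primeFactors_eq {W : ℕ} (hW : W ≠ 0) {s : ℂ}
    (hs : ∀ p ∈ W.primeFactors, ‖s‖ * Real.log p ≤ 1) :
    ∃ ρ : ℂ, (∏ p ∈ W.primeFactors, (1 - (p : ℂ) ^ (-(1 + s)))) =
        ((Nat.totient W : ℝ) / W : ℝ) * ρ ∧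
      ‖ρ - 1‖ ≤ Real.exp (2 * ‖s‖ * W.primeFactors.card) - 1 := by
  set θ : ℕ → ℂ := fun p => (1 - (p : ℂ) ^ (-s)) / ((p : ℂ) - 1) with hθ
  refine ⟨∏ p ∈ W.primeFactors, (1 + θ p), ?_, ?_⟩
  · rw [totient_div_eq_prod hW, Complex.ofReal_prod, ← Finset.prod_mul_distrib]
    refine Finset.prod_congr rfl fun p hp => ?_
    have hpp := Nat.prime_of_mem_primeFactors hp
    have hp0 : (p : ℂ) ≠ 0 := by exact_mod_cast hpp.ne_zero
    have hp1 : (p : ℂ) - 1 ≠ 0 := sub_ne_zero.2 (by exact_mod_cast hpp.one_lt.ne')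
    rw [← cpow_neg_div_natCast hpp.ne_zero, hθ]
    push_cast
    field_simp
    ring
  · refine (Finset.norm_prod_one_add_sub_one_le _ _).trans ?_
    have hsum : ∑ p ∈ W.primeFactors, ‖θ p‖ ≤ 2 * ‖s‖ * W.primeFactors.card := by
      have hle : ∀ p ∈ W.primeFactors, ‖θ p‖ ≤ 2 * ‖s‖ := by
        intro p hp
        have hpp := Nat.prime_of_mem_primeFactors hp
        have hp2 := hpp.two_le
        have hp1r : (1 : ℝ) < p := by exact_mod_cast hpp.one_lt
        have hnorm : ‖(p : ℂ) - 1‖ = (p : ℝ) - 1 := by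
          have : ((p : ℂ) - 1) = (((p : ℝ) - 1 : ℝ) : ℂ) := by push_cast; ring
          rw [this, Complex.norm_real, Real.norm_eq_abs, abs_of_pos (by linarith)]
        rw [hθ]; simp only
        rw [norm_div, hnorm, div_le_iff₀ (by linarith)]
        have h1 := norm_one_sub_cpow_neg_le hp2 (hs p hp)
        have hlog : Real.log p ≤ (p : ℝ) - 1 := Real.log_le_sub_one_of_pos (by linarith)
        have hs0 : 0 ≤ ‖s‖ := norm_nonneg _
        nlinarith
      calc ∑ p ∈ W.primeFactors, ‖θ p‖ ≤ ∑ _p ∈ W.primeFactors, 2 * ‖s‖ := Finset.sum_le_sum hle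
        _ = 2 * ‖s‖ * W.primeFactors.card := by rw [Finset.sum_const, nsmul_eq_mul]; ring
    linarith [Real.exp_le_exp.2 hsum]

end LcmEuler

end Literature.NumberTheory.Sieve
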